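import Literature.Topology.FourManifolds.MMSWRasmussenFacts
import Literature.Topology.FourManifolds.MMSWRasmussenGeneralPosition
import Summits.SmoothPoincare4.SmoothPoincare4.Theses.DottedCircleRasmussen

/-!
# Helper `helper_friendsCarrier_Vk_bandDisc` (piece 9 of the registered helper `helper_friendsCarrier_Vk`,
stub `stub_friendsCarrier`, line `mk_friends`, skeleton v5) for crux `DcrGap`
(item stmt-SmoothPoincare4-16128, route route-SmoothPoincare4-DottedCircleRasmussen)

**The deep part of the slice disc stays out of a thin band around `M_k`.**  For a model slice disc
`f₁` (interior off `D_k`) and `δ > 0` there is `ε₀ > 0` such that every point `f₁ x`, `‖x‖ ≤ 1`, which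
lies off the poles (`|z - c_j|² > 1/2`) with `G_k(f₁ x) < 1 + ε₀` has `‖x‖ > 1 - δ`.  With
`helper_friendsCarrier_Vk_discFlowLinesNeat` (near the circle the disc is swept by the flow lines of the
adapted field at levels `1 + s`) this identifies the disc inside the collar band `{1 ≤ G_k < 1 + 2ε}`
with the product `K₁ × [0, 2ε)` for every `2ε ≤ ε₀`.  Proof: Cantor's intersection theorem
(`IsCompact.elim_directed_family_closed`) for the compact deep disc `f₁(B̄(0, 1 - δ))`, which misses
`D_k`, against the closed bands `{∀ j, |z - c_j|² ≥ 1/2} ∩ {G_k ≤ 1 + 1/(n+1)}`, whose intersection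
lies in `D_k` (a hole term in `[1/2, 1)` forces `G_k > 1`).

No definitions, no named facts, no `sorry`.
-/

-- the prescribed namespace `Summit.<P>.<Sub>.…` duplicates `SmoothPoincare4` (P = Sub)
set_option linter.dupNamespace false
set_option linter.style.longLine false

noncomputable section

open scoped Manifold ContDiff Topology
open Set Function Metric Filter
open Literature.Topology.FourManifolds Literature.Topology.FourManifolds.MMSW

namespace Summit.SmoothPoincare4.SmoothPoincare4.Theorems.DcrGap.MkFriends

namespace FriendsCarrierVk

/-- A point with all hole terms `≥ 1/2` and `G_k ≤ 1` lies in `D_k` (a hole term `< 1` would alone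
make `G_k > 1`). [folklore] -/
theorem mem_modelHandlebody_of_half_le {k : ℕ} {y : EuclideanSpace ℝ (Fin 4)}
    (hy : ∀ j, (1 : ℝ) / 2 ≤ holeTerm k j y) (hG : levelFun k y ≤ 1) : y ∈ modelHandlebody k := by
  refine ⟨fun j => ?_, hG⟩
  by_contra h
  push Not at h
  have hpos : ∀ j, 0 < holeTerm k j y := fun j => lt_of_lt_of_le (by norm_num) (hy j)
  have hS : ∀ i, 0 ≤ 1 / holeTerm k i y := fun i => (one_div_pos.2 (hpos i)).le
  have hj : 1 < 1 / holeTerm k j y := by rw [lt_one_div one_pos (hpos j), div_one]; exact h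
  have hsum : 1 / holeTerm k j y ≤ ∑ i : Fin k, 1 / holeTerm k i y :=
    Finset.single_le_sum (fun i _ => hS i) (Finset.mem_univ j)
  have h1 : 0 ≤ ((y 0) ^ 2 + (y 1) ^ 2) / (40 * ((k : ℝ) + 1)) ^ 2 := by positivity
  have : 1 < levelFun k y := by
    unfold levelFun
    nlinarith [sq_nonneg (y 2), sq_nonneg (y 3)]
  linarith

/-- **The deep disc misses thin bands around `M_k`.** [folklore] -/
theorem exists_bandDisc {k : ℕ} {K₁ : (sphere (0 : EuclideanSpace ℝ (Fin 2)) 1) → EuclideanSpace ℝ (Fin 4)}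
    {f₁ : EuclideanSpace ℝ (Fin 2) → EuclideanSpace ℝ (Fin 4)} (hf : IsModelSliceDisc k K₁ f₁) {δ : ℝ} (hδ : 0 < δ) :
    ∃ ε₀ : ℝ, 0 < ε₀ ∧ ∀ x ∈ closedBall (0 : EuclideanSpace ℝ (Fin 2)) 1,
      (∀ j, (1 : ℝ) / 2 < holeTerm k j (f₁ x)) → levelFun k (f₁ x) < 1 + ε₀ → 1 - δ < ‖x‖ := by
  have hfc : Continuous f₁ := hf.1.continuous
  -- the compact deep disc, off `D_k`
  set Kd : Set (EuclideanSpace ℝ (Fin 4)) := f₁ '' closedBall (0 : EuclideanSpace ℝ (Fin 2)) (1 - δ) with hKd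
  have hKc : IsCompact Kd := (isCompact_closedBall _ _).image hfc
  have hKD : ∀ y ∈ Kd, y ∉ modelHandlebody k := by
    rintro _ ⟨x, hx, rfl⟩
    exact hf.apply_notMem (lt_of_le_of_lt (mem_closedBall_zero_iff.1 hx) (by linarith))
  -- the closed bands
  set C : ℕ → Set (EuclideanSpace ℝ (Fin 4)) := fun n =>
    {y | ∀ j : Fin k, (1 : ℝ) / 2 ≤ holeTerm k j y} ∩ levelFun k ⁻¹' Iic (1 + 1 / ((n : ℝ) + 1)) with hC
  have hCc : ∀ n, IsClosed (C n) := fun n =>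
    (continuousOn_levelFun (by norm_num : (0 : ℝ) < 1 / 2)).preimage_isClosed_of_isClosed (isClosed_guard (1 / 2)) isClosed_Iic
  have hCanti : ∀ ⦃i j : ℕ⦄, i ≤ j → C i ⊇ C j := by
    intro i j hij y hy
    refine ⟨hy.1, ?_⟩
    have h1 : (1 : ℝ) / ((j : ℝ) + 1) ≤ 1 / ((i : ℝ) + 1) :=
      one_div_le_one_div_of_le (by positivity) (by exact_mod_cast Nat.add_le_add_right hij 1)
    have h2 : levelFun k y ≤ 1 + 1 / ((j : ℝ) + 1) := hy.2
    show levelFun k y ≤ 1 + 1 / ((i : ℝ) + 1)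
    linarith
  have hdir : Directed (· ⊇ ·) C := directed_of_isDirected_le hCanti
  -- the intersection of the bands lies in `D_k`, hence misses the deep disc
  have hint : Kd ∩ ⋂ n, C n = ∅ := by
    refine eq_empty_iff_forall_notMem.2 fun y ⟨hyK, hyC⟩ => hKD y hyK ?_
    rw [mem_iInter] at hyC
    have hhalf : ∀ j, (1 : ℝ) / 2 ≤ holeTerm k j y := (hyC 0).1
    refine mem_modelHandlebody_of_half_le hhalf (le_of_forall_pos_lt_add fun e he => ?_)
    obtain ⟨n, hn⟩ := exists_nat_one_div_lt he
    have h2 : levelFun k y ≤ 1 + 1 / ((n : ℝ) + 1) := (hyC n).2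
    linarith
  obtain ⟨n, hn⟩ := hKc.elim_directed_family_closed C hCc hint hdir
  refine ⟨1 / ((n : ℝ) + 1), by positivity, fun x hx hh hG => ?_⟩
  by_contra hxd
  push Not at hxd
  have hyK : f₁ x ∈ Kd := ⟨x, mem_closedBall_zero_iff.2 hxd, rfl⟩
  have hyC : f₁ x ∈ C n := ⟨fun j => (hh j).le, mem_Iic.2 hG.le⟩
  have : f₁ x ∈ Kd ∩ C n := ⟨hyK, hyC⟩
  rw [hn] at this
  exact this

end FriendsCarrierVk

open FriendsCarrierVk in
/-- **Helper `helper_friendsCarrier_Vk_bandDisc`** (registered piece of `helper_friendsCarrier_Vk`: the deep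
part of the slice disc stays out of thin bands around `M_k`).  For a model slice disc `f₁` and `δ > 0`
there is `ε₀ > 0` such that a point `f₁ x` (`‖x‖ ≤ 1`) off the poles with `G_k(f₁ x) < 1 + ε₀` has
`‖x‖ > 1 - δ`. [folklore] -/
theorem helper_friendsCarrier_Vk_bandDisc : ∀ (k : ℕ) (K₁ : (Metric.sphere (0 : EuclideanSpace ℝ (Fin 2)) 1) → EuclideanSpace ℝ (Fin 4)) (f₁ : EuclideanSpace ℝ (Fin 2) → EuclideanSpace ℝ (Fin 4)), Literature.Topology.FourManifolds.MMSW.IsModelSliceDisc k K₁ f₁ → ∀ δ : ℝ, 0 < δ → ∃ ε₀ : ℝ, 0 < ε₀ ∧ ∀ x ∈ Metric.closedBall (0 : EuclideanSpace ℝ (Fin 2)) 1, (∀ j, (1 : ℝ) / 2 < Literature.Topology.FourManifolds.MMSW.holeTerm k j (f₁ x)) → Literature.Topology.FourManifolds.MMSW.levelFun k (f₁ x) < 1 + ε₀ → 1 - δ < ‖x‖ :=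
  fun _ _ _ hf _ hδ => exists_bandDisc hf hδ

end Summit.SmoothPoincare4.SmoothPoincare4.Theorems.DcrGap.MkFriends

end
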